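import Summits.ResolutionOfSingularities.ResolutionOfSingularities.Theorems.MarkedTransferCampaignW46ThreefoldsGammaFreeGlobalIntersectionNoether
import HarnessLib

/-!
# [OURS · L1 W4.6 rung (ii) ladder support] STRICT TRANSFORMS OF BRANCHES UNDER THE POINT BLOW-UP OF A REGULAR SURFACE, III:
# SEPARATION OF TRANSVERSAL BRANCHES AND M. NOETHER'S DROP OF THE INTERSECTION NUMBER (brick for the `d = 2` rung (ii-2),
# design point (3) of the holder's RUNG-II-2-PLAN, wish-list items (I3), (I5))

Cell res-hironaka, LADDER-RESOLUTION rung L (D-0089), slot W4.6, rung (ii); seat res-L1-s46-pv-10 = res-D-pv-047, filed as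
SUPPORT for the `d = 2` rung (holder res-L1-s46-pv-11 = res-D-pv-049, GO 2026-08-27T05:30:58Z). Host route MarkedTransfer,
host item `HypersurfaceOrderReductionDimLeThree` (stmt-ResolutionOfSingularities-16156), `--kind proof --supports … --as helper`.
Sequel of parts `…Intersection.lean` (p504615), `…IntersectionBlowup.lean` (p505558), `…IntersectionNoether.lean`; same
setting (quadratic transforms `R₁` of the two-dimensional regular local ring `R ⊆ K = Frac R` = the closed points of the
exceptional curve `E` when `ringKrullDim R₁ = 2`; chart elements `x`, `R[𝔪/x] ⊆ R₁`, `𝔪 R₁ = x R₁`; strict transform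
`f/x` of a regular branch `f`; intersection numbers `i(f, g) = λ_R(R/(f, g))` as `Module.length`, DEF-FREE). Classical
(M. Noether's formula `i_P(C, D) = m_P(C) m_P(D) + Σ_{P′ → P} i_{P′}(C̃, D̃)`, here with `m_P(C) = m_P(D) = 1`:
Hartshorne V Ex. 3.2); nothing is a statement of the manuscript under adjudication; no typed `Hironaka2017` candidate and no
unproved named fact enters. AI-written; weaker than expert review.

## What is proved

* `not_div_mem_maximalIdeal_and_of_span_pair_eq` — **(I5/I3, `i = 1`) SEPARATION: if `(f, g) = 𝔪` (transversal branches,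
  `i(f, g) = 1`) then at no quadratic transform are both `f/x` and `g/x` non-units** — the strict transforms meet `E` at
  different points; `two_le_length_of_div_mem_maximalIdeal` — contrapositive: a common point forces `i(f, g) ≥ 2`.
* `length_quotient_strictTransform_add_one` — **(I3) M. NOETHER'S DROP: for `𝔪 = (x, f)`, `g ∈ 𝔪`, `f ∤ g`, at the point
  `R₁` of the strict transform of `f`: `λ_{R₁}(R₁/(f/x, g/x)) + 1 = λ_R(R/(f, g))`**; `length_quotient_strictTransform_add_one'`
  — the same for any chart element `x` of `R₁` (regular `f`); `div_mem_maximalIdeal_of_two_le_length`,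
  `div_mem_maximalIdeal_iff_of_two_le_length` — **if `i(f, g) ≥ 2` the strict transforms of the regular branches `f`, `g`
  pass through the same points of `E`** (hence, by part II, through exactly one common point, with intersection number
  `i(f, g) − 1` there).
* `strictTransform_regular_transversal` — at the point of `f`: `f/x ∉ 𝔪_{R₁}²`, `x ∉ 𝔪_{R₁}²`, `λ_{R₁}(R₁/(x, f/x)) = 1`
  (the strict transform is regular and meets `E` transversally, **(I4)**).

References: R. Hartshorne, *Algebraic Geometry* (1977), Ch. V §3: Prop. 3.6, Cor. 3.7, Ex. 3.2 [Hartshorne1977]; C. Huneke,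
I. Swanson, *Integral Closure of Ideals, Rings, and Modules* (2006), §14 [HunekeSwanson2006]; J. Chalmovianská, P. Chalmovianský,
*Computing local intersection multiplicity of plane curves via blowup*, arXiv:1905.00701 (2019), §3 (the blow-up recursion
`ℬ_P(f, g) = m_P(f) m_P(g) + Σ_Q ℬ_Q(f′, g′)` and its agreement with Fulton's intersection number) — context. H. Hironaka,
ms. 2017-03-23 — scope only, under adjudication, not cited as fact. [Hironaka2017]
-/

noncomputable section

set_option linter.dupNamespace false

open IsLocalRing Polynomial

namespace Summit.ResolutionOfSingularities.ResolutionOfSingularities.Theorems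

namespace CampaignW46

open Literature.AlgebraicGeometry.Resolution

universe u

variable {K : Type u} [Field K] {R R₁ : Subring K} [IsRegularLocalRing R]

/-! ## Two branches under the blow-up: separation and M. Noether's drop of the intersection number -/

section Noether

/-- **Transversal branches are separated by one blow-up.** If `(f, g) = 𝔪` (intersection number `1`,
`length_quotient_span_pair_eq_one_iff`) then at NO quadratic transform `R₁` are both `f/x` and `g/x`
non-units (`x ∈ 𝔪` any element with `f/x, g/x ∈ R₁`, e.g. a chart element of `R₁`): writing
`x = a f + b g` gives `1 = a · f/x + b · g/x`. [cite: Hartshorne1977, Ch. V Ex. 3.2] -/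
theorem not_div_mem_maximalIdeal_and_of_span_pair_eq [IsLocalRing R₁] (hle : R ≤ R₁) {x f g : R}
    (hfg : Ideal.span {f, g} = maximalIdeal R) (hx : x ∈ maximalIdeal R) (hx0 : x ≠ 0)
    (hfx : ((f : R) : K) / x ∈ R₁) (hgx : ((g : R) : K) / x ∈ R₁) :
    ¬ ((⟨_, hfx⟩ : R₁) ∈ maximalIdeal R₁ ∧ (⟨_, hgx⟩ : R₁) ∈ maximalIdeal R₁) := by
  rintro ⟨hu, hv⟩
  have hx0K : ((x : R) : K) ≠ 0 := fun e => hx0 (Subtype.ext e)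
  rw [← hfg, Ideal.mem_span_pair] at hx
  obtain ⟨a, b, hab⟩ := hx
  apply (maximalIdeal.isMaximal R₁).ne_top
  rw [Ideal.eq_top_iff_one]
  have e : (1 : R₁) = Subring.inclusion hle a * ⟨_, hfx⟩ + Subring.inclusion hle b * ⟨_, hgx⟩ :=
    Subtype.ext (by
      change (1 : K) = (a : K) * (((f : R) : K) / x) + (b : K) * (((g : R) : K) / x)
      have := congrArg (fun t : R => (t : K)) hab
      simp only [Subring.coe_add, Subring.coe_mul] at this
      field_simp
      linear_combination (-1 : K) * this)
  rw [e]
  exact Ideal.add_mem _ (Ideal.mul_mem_left _ _ hu) (Ideal.mul_mem_left _ _ hv)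

/-- **M. NOETHER'S DROP OF THE INTERSECTION NUMBER (one regular branch).** Let `𝔪 = (x, f)` (`f` a regular
branch, `x` a transversal parameter), `g ∈ 𝔪` with `f ∤ g`, and let `R₁` be the (unique) two-dimensional
quadratic transform of `R` through which the strict transform `f/x` of `f` passes. Then
**`λ_{R₁}(R₁/(f/x, g/x)) + 1 = λ_R(R/(f, g))`** — for a regular `g`, `g/x` is its strict transform, so the
intersection number of the two strict transforms at their only possible common point over the centre is
`i(f, g) − 1 = i(f, g) − m(f) m(g)`. (Normal form `g = u xⁿ + f h` with `n = i(f, g)`; then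
`g/x = u xⁿ⁻¹ + (f/x) h` and `𝔪_{R₁} = (x, f/x)`.) [cite: Hartshorne1977, Ch. V Ex. 3.2] -/
theorem length_quotient_strictTransform_add_one [IsLocalRing R₁] (h₁ : IsQuadraticTransform R R₁)
    (hdim : ringKrullDim R = 2) (hRK : IsLocalRingOf R) (hd₁ : ringKrullDim R₁ = 2) {x f g : R}
    (hm : maximalIdeal R = Ideal.span {x, f}) (hg : g ∈ maximalIdeal R) (hfg : ¬ f ∣ g)
    {hfx : ((f : R) : K) / x ∈ R₁} (hu : (⟨_, hfx⟩ : R₁) ∈ maximalIdeal R₁)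
    (hgx : ((g : R) : K) / x ∈ R₁) :
    Module.length R₁ (R₁ ⧸ Ideal.span {(⟨_, hfx⟩ : R₁), ⟨_, hgx⟩}) + 1 =
      Module.length R (R ⧸ Ideal.span {f, g}) := by
  haveI := isRegularLocalRing_of_isQuadraticTransform h₁ hdim hRK hd₁
  have hf : f ∈ maximalIdeal R := hm ▸ Ideal.subset_span (by simp)
  have hx0 : x ≠ 0 := by
    rintro rfl; exact not_mem_sq_of_span_pair hdim hm (Ideal.zero_mem _)
  have hx0K : ((x : R) : K) ≠ 0 := fun e => hx0 (Subtype.ext e)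
  obtain ⟨n, u, h, huu, hgeq, hlen⟩ := exists_eq_unit_mul_pow_add_mul hdim hm hfg
  have hn : 1 ≤ n := by
    have h1 : (1 : ℕ∞) ≤ Module.length R (R ⧸ Ideal.span {f, g}) :=
      (one_le_length_quotient_span_pair_iff hf g).mpr hg
    rw [hlen] at h1
    exact_mod_cast h1
  have hm₁ := maximalIdeal_eq_span_pair_of_div_mem_maximalIdeal h₁ hdim hm hu
  set ι := Subring.inclusion h₁.dominates.1 with hι
  -- `g/x = u x^{n-1} + (f/x) h` in `R₁`
  have hgx' : (⟨_, hgx⟩ : R₁) = ι u * ι x ^ (n - 1) + ⟨_, hfx⟩ * ι h := Subtype.ext (by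
    change ((g : R) : K) / x = (u : K) * (x : K) ^ (n - 1) + ((f : R) : K) / x * (h : K)
    have e := congrArg (fun t : R => (t : K)) hgeq
    simp only [Subring.coe_add, Subring.coe_mul, Subring.coe_pow] at e
    rw [e]
    obtain ⟨k, rfl⟩ : ∃ k, n = k + 1 := ⟨n - 1, by omega⟩
    rw [Nat.add_sub_cancel, pow_succ]
    field_simp)
  rw [hgx', length_quotient_span_pair_unit_mul_pow_add hd₁ hm₁ (huu.map ι) (n - 1) (ι h), hlen]
  norm_cast
  exact Nat.sub_add_cancel hn

/-- **Tangent branches stay together for one blow-up**: if `i(f, g) ≥ 2` then at the point `R₁` of the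
strict transform of the regular branch `f` (`𝔪 = (x, f)`, `f/x ∈ 𝔪_{R₁}`) also `g/x` is a non-unit — for a
regular `g` its strict transform passes through the same point (which by `eq_of_div_mem_maximalIdeal` is
then THE point of `g` as well). [cite: Hartshorne1977, Ch. V Ex. 3.2] -/
theorem div_mem_maximalIdeal_of_two_le_length [IsLocalRing R₁] (h₁ : IsQuadraticTransform R R₁)
    (hdim : ringKrullDim R = 2) (hRK : IsLocalRingOf R) (hd₁ : ringKrullDim R₁ = 2) {x f g : R}
    (hm : maximalIdeal R = Ideal.span {x, f})
    (h2 : 2 ≤ Module.length R (R ⧸ Ideal.span {f, g}))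
    {hfx : ((f : R) : K) / x ∈ R₁} (hu : (⟨_, hfx⟩ : R₁) ∈ maximalIdeal R₁)
    (hgx : ((g : R) : K) / x ∈ R₁) : (⟨_, hgx⟩ : R₁) ∈ maximalIdeal R₁ := by
  have hf : f ∈ maximalIdeal R := hm ▸ Ideal.subset_span (by simp)
  have hf2 : f ∉ maximalIdeal R ^ 2 := not_mem_sq_of_span_pair' hdim hm
  have hg : g ∈ maximalIdeal R :=
    (one_le_length_quotient_span_pair_iff hf g).mp (le_trans (by norm_num) h2)
  have hx0 : x ≠ 0 := by
    rintro rfl; exact not_mem_sq_of_span_pair hdim hm (Ideal.zero_mem _)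
  have hx0K : ((x : R) : K) ≠ 0 := fun e => hx0 (Subtype.ext e)
  by_cases hfg : f ∣ g
  · -- `g = f c`: `g/x = (f/x) c`
    obtain ⟨c, rfl⟩ := hfg
    have e : (⟨_, hgx⟩ : R₁) = ⟨_, hfx⟩ * Subring.inclusion h₁.dominates.1 c := Subtype.ext (by
      change (((f * c : R) : K)) / x = ((f : R) : K) / x * (c : K)
      rw [Subring.coe_mul]; ring)
    rw [e]
    exact Ideal.mul_mem_right _ _ hu
  have hdrop := length_quotient_strictTransform_add_one h₁ hdim hRK hd₁ hm hg hfg hu hgx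
  have h1 : 1 ≤ Module.length R₁ (R₁ ⧸ Ideal.span {(⟨_, hfx⟩ : R₁), ⟨_, hgx⟩}) := by
    rcases eq_or_ne (Module.length R₁ (R₁ ⧸ Ideal.span {(⟨_, hfx⟩ : R₁), ⟨_, hgx⟩})) 0 with h0 | h0
    · exfalso
      rw [h0, zero_add] at hdrop
      rw [← hdrop] at h2
      exact absurd h2 (by norm_num)
    · exact Order.one_le_iff_ne_zero.mpr h0
  rw [one_le_length_quotient_iff, Ideal.span_le] at h1
  exact h1 (by simp)

/-- **At the point of a regular branch, the strict transform is regular and transversal to `E`**: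
with `𝔪 = (x, f)` and `f/x ∈ 𝔪_{R₁}` (`R₁` two-dimensional): `f/x ∉ 𝔪_{R₁}²`, `x ∉ 𝔪_{R₁}²`, and the
local intersection number of `E : x = 0` with the strict transform `f/x = 0` at `R₁` is
`λ_{R₁}(R₁/(x, f/x)) = 1`. [cite: Hartshorne1977, Ch. V Cor. 3.7 (r = 1)] -/
theorem strictTransform_regular_transversal [IsLocalRing R₁] (h₁ : IsQuadraticTransform R R₁)
    (hdim : ringKrullDim R = 2) (hRK : IsLocalRingOf R) (hd₁ : ringKrullDim R₁ = 2) {x f : R}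
    (hm : maximalIdeal R = Ideal.span {x, f})
    {hfx : ((f : R) : K) / x ∈ R₁} (hu : (⟨_, hfx⟩ : R₁) ∈ maximalIdeal R₁) :
    (⟨_, hfx⟩ : R₁) ∉ maximalIdeal R₁ ^ 2 ∧
      Subring.inclusion h₁.dominates.1 x ∉ maximalIdeal R₁ ^ 2 ∧
      Module.length R₁ (R₁ ⧸ Ideal.span {Subring.inclusion h₁.dominates.1 x, (⟨_, hfx⟩ : R₁)}) = 1 := by
  haveI := isRegularLocalRing_of_isQuadraticTransform h₁ hdim hRK hd₁
  have hm₁ := maximalIdeal_eq_span_pair_of_div_mem_maximalIdeal h₁ hdim hm hu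
  exact ⟨not_mem_sq_of_span_pair' hd₁ hm₁, not_mem_sq_of_span_pair hd₁ hm₁,
    (length_quotient_span_pair_eq_one_iff _ _).mpr hm₁.symm⟩

/-! ## Chart-agnostic summary at a closed point of the exceptional curve

For the holder's loop: `R₁` any two-dimensional quadratic transform of `R` (a closed point of `E`) with ANY
chart element `x` (`x ∈ 𝔪 ∖ 0`, `R[𝔪/x] ⊆ R₁` — e.g. the one in the definition of `IsQuadraticTransform`),
`f, g` two distinct REGULAR branches through the centre. "The strict transform of `f` passes through `R₁`"
reads `f/x ∈ 𝔪_{R₁}` (equivalently `x/f ∉ R₁`, `div_mem_maximalIdeal_iff_not_mem`). -/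

/-- **(I3), transversal case, any chart: if both strict transforms pass through `R₁` then `i(f, g) ≥ 2`.**
(Only `f, g ∈ 𝔪` and `R ⊆ R₁` local rings are used.) [cite: Hartshorne1977, Ch. V Ex. 3.2] -/
theorem two_le_length_of_div_mem_maximalIdeal [IsLocalRing R₁] (hle : R ≤ R₁) {x f g : R}
    (hx : x ∈ maximalIdeal R) (hx0 : x ≠ 0) (hf : f ∈ maximalIdeal R) (hg : g ∈ maximalIdeal R)
    {hfx : ((f : R) : K) / x ∈ R₁} (hu : (⟨_, hfx⟩ : R₁) ∈ maximalIdeal R₁)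
    {hgx : ((g : R) : K) / x ∈ R₁} (hv : (⟨_, hgx⟩ : R₁) ∈ maximalIdeal R₁) :
    2 ≤ Module.length R (R ⧸ Ideal.span {f, g}) := by
  have h1 : 1 ≤ Module.length R (R ⧸ Ideal.span {f, g}) :=
    (one_le_length_quotient_span_pair_iff hf g).mpr hg
  have hne : Module.length R (R ⧸ Ideal.span {f, g}) ≠ 1 := by
    intro h
    exact not_div_mem_maximalIdeal_and_of_span_pair_eq hle
      ((length_quotient_span_pair_eq_one_iff f g).mp h) hx hx0 hfx hgx ⟨hu, hv⟩
  have hlt : (1 : ℕ∞) < Module.length R (R ⧸ Ideal.span {f, g}) := lt_of_le_of_ne h1 (Ne.symm hne)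
  exact Order.add_one_le_of_lt hlt

/-- **(I3), tangent case, any chart: if `i(f, g) ≥ 2` then the strict transforms of the regular branches
`f` and `g` pass through the same closed points of `E`**: `f/x ∈ 𝔪_{R₁} ↔ g/x ∈ 𝔪_{R₁}` (so, with
`eq_of_regular_of_div_mem_maximalIdeal`, through exactly one common point, where by
`length_quotient_strictTransform_add_one` their intersection number is `i(f, g) − 1`).
[cite: Hartshorne1977, Ch. V Ex. 3.2] -/
theorem div_mem_maximalIdeal_iff_of_two_le_length [IsLocalRing R₁] (h₁ : IsQuadraticTransform R R₁)
    (hdim : ringKrullDim R = 2) (hRK : IsLocalRingOf R) (hd₁ : ringKrullDim R₁ = 2) {x f g : R}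
    (hx : x ∈ maximalIdeal R) (hx0 : x ≠ 0) (hA : blowupRing R (x : K) ≤ R₁)
    (hf : f ∈ maximalIdeal R) (hf2 : f ∉ maximalIdeal R ^ 2)
    (hg : g ∈ maximalIdeal R) (hg2 : g ∉ maximalIdeal R ^ 2)
    (h2 : 2 ≤ Module.length R (R ⧸ Ideal.span {f, g}))
    (hfx : ((f : R) : K) / x ∈ R₁) (hgx : ((g : R) : K) / x ∈ R₁) :
    (⟨_, hfx⟩ : R₁) ∈ maximalIdeal R₁ ↔ (⟨_, hgx⟩ : R₁) ∈ maximalIdeal R₁ := by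
  constructor
  · intro hu
    have hm := maximalIdeal_eq_span_pair_of_regular_of_div_mem_maximalIdeal h₁ hdim hx hx0 hA hf hf2 hu
    exact div_mem_maximalIdeal_of_two_le_length h₁ hdim hRK hd₁ hm h2 hu hgx
  · intro hv
    have hm := maximalIdeal_eq_span_pair_of_regular_of_div_mem_maximalIdeal h₁ hdim hx hx0 hA hg hg2 hv
    rw [Ideal.span_pair_comm] at h2
    exact div_mem_maximalIdeal_of_two_le_length h₁ hdim hRK hd₁ hm h2 hv hfx

/-- **(I3), the drop, any chart**: for two distinct regular branches `f, g` and a two-dimensional quadratic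
transform `R₁ ⊇ R[𝔪/x]` through which the strict transform of `f` passes,
`λ_{R₁}(R₁/(f/x, g/x)) + 1 = i(f, g)` (the left length is `0`, i.e. `g/x` is a unit there, exactly when
`i(f, g) = 1`). [cite: Hartshorne1977, Ch. V Ex. 3.2] -/
theorem length_quotient_strictTransform_add_one' [IsLocalRing R₁] (h₁ : IsQuadraticTransform R R₁)
    (hdim : ringKrullDim R = 2) (hRK : IsLocalRingOf R) (hd₁ : ringKrullDim R₁ = 2) {x f g : R}
    (hx : x ∈ maximalIdeal R) (hx0 : x ≠ 0) (hA : blowupRing R (x : K) ≤ R₁)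
    (hf : f ∈ maximalIdeal R) (hf2 : f ∉ maximalIdeal R ^ 2) (hg : g ∈ maximalIdeal R) (hfg : ¬ f ∣ g)
    {hfx : ((f : R) : K) / x ∈ R₁} (hu : (⟨_, hfx⟩ : R₁) ∈ maximalIdeal R₁)
    (hgx : ((g : R) : K) / x ∈ R₁) :
    Module.length R₁ (R₁ ⧸ Ideal.span {(⟨_, hfx⟩ : R₁), ⟨_, hgx⟩}) + 1 =
      Module.length R (R ⧸ Ideal.span {f, g}) :=
  length_quotient_strictTransform_add_one h₁ hdim hRK hd₁
    (maximalIdeal_eq_span_pair_of_regular_of_div_mem_maximalIdeal h₁ hdim hx hx0 hA hf hf2 hu) hg hfg hu hgx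

end Noether

end CampaignW46

end Summit.ResolutionOfSingularities.ResolutionOfSingularities.Theorems

end
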